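import Summits.ABC.IUTFork.Cor312PilotKummerNaturalAct
import Summits.ABC.IUTFork.Repair.CandInternal14
import Summits.ABC.IUTFork.Repair.CandInternal11
import HarnessLib

/-!
# IUT REPAIR BRANCH (rung LADDER-ABC:A2.RP), class (i) INTERNAL, sub-cell B0, seat rp-d2 — `CandInternal2NatAct`: the P♮⁺ CELLS (honest-action
# natural model) of the log-shell rows RP-I05 / I05c / I06 / I06b / I06c / I06d / I18 — all HOLD, with S non-identified and the Statement strict

Proof-only file (D-0012) of the abc-iut cell, IUT REPAIR branch (REPAIR-SPEC v0.4 §PROFILE; RULINGS #11 «every level-H/S row gets a P♮ cell»,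
#18 «natData.act := 0 ⇒ DEGENERATE ✗ at P♮ … is a NONZERO-act variant cheap?»). TAKES NO SIDE on [IUTchIII] Cor. 3.12 or on any author;
candidates stay hypotheses; typed ≠ proved; one helper predicate def (`shellTuple`, unasserted bookkeeping), no `Prop` fact; standard
axioms (header amended 2026-08-26 per aud-2 RQ7 DEFECT on p431599: declaration content now described accurately; kernel content unchanged). The bed is `Cor312PilotKummerNaturalAct` (P♮⁺ =
abc-iut-w5-d230's P♮ with the action (i)(b) := coordinatewise multiplication; typed Thm 3.11, pins, S through `flipFamily`, hull clause,
strict Statement).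

CELLS at P♮⁺ (`actFull`, `actSetting`, `segRegion`, `qDatumNat`): the log-shell saturation of the Θ-datum is now CONTENTFUL — `Ψ·𝓘 =` all
tuples of shell elements (`shellSat_act_PsiNat`), whose segment region is the whole shell `ball` (`segRegion_shellSat_act`). Hence:
RP-I05 ✓ (`hInd3Hull_act`), RP-I05c ✓ (`h11_act`), RP-I06 ✓ (`hQShellOrbit_act`), RP-I06b ✓ (`hQShellOrbitData_act`), RP-I06c ✓ (`h5_act`),
**RP-I18 ✓ (`h14_act`: the (Ind2)-move `flipFamily` IS 𝓘-inner — `−1` lies in the shell)**, RP-I06d q-half ✓ (`hQInShell_act`), inflation half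
✓ on `𝔽_l^⋇` (`hShellInHull_act_labelSucc`). With the bed's SAT♮ engine: `I05_I06_satNatural`, `I18_satNatural` — SAT♮ witnesses (S holds
NON-identified through a genuine indeterminacy, Statement STRICT) for the whole log-shell class. READING (census, neutral): this is RP-I18's
decomposition clause in the kernel — where the Θ→q move is UNIT-valued (here the sign `−1 ∈ 𝒪^× ⊆ 𝓘`), innerness, RP-I06 and S all hold
for free; the class's content lies entirely in the value-group discrepancy (fat model: `H_fat_iff`, 3 ≤ d). [claim: Mochizuki2012, status: disputed]
-/

noncomputable section

open Set

namespace Summit.ABC.IUTFork.Repair.CandInternal2NatAct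

open Thm311 Cor312 Cor312Vol Literature.IUT.LogThetaLattice Summit.ABC.IUTFork.Repair.CandInternal2
  Cor312.Checks Cor312.IdentifiedNonVacuity Cor312Vol.NaiveWitness Cor312Vol.PinnedWitness Cor312Vol.NaturalWitness
  Cor312Vol.NaturalActWitness

/-- A tuple of shell elements. [folklore] -/
def shellTuple (v : toyIndex.V) (ι : signShells.StarPacket v) : Prop := ∀ j : toyIndex.LabelStar, ι j ∈ ball j.1 (toyIndex.over v)

/-- **In P♮⁺ the log-shell saturation of the Θ-datum is CONTENTFUL: `Ψ·𝓘 =` the tuples of shell elements** (`onePt · ι = ι`). [folklore] -/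
theorem shellSat_act_PsiNat (n : ℤ) (v : toyIndex.V) (hv : v ∈ toyIndex.Vbad) (ι : signShells.StarPacket v) :
    ι ∈ shellSat actFull.toLatticeSituation n (fun v _ => PsiNat v) v hv ↔ shellTuple v ι := by
  constructor
  · rintro ⟨ψ, hψ, ι', hι', rfl⟩
    have hψ1 : ψ = onePt v := hψ
    rw [hψ1, act_onePt]
    exact hι'
  · intro hι
    exact ⟨onePt v, rfl, ι, hι, (act_onePt n v hv ι).symm⟩

/-- **Its segment region at a label of `𝔽_l^⋇` is the whole shell `ball`** (the shell is balanced: `t·y ∈ ball` for `0 ≤ t ≤ 1`). [folklore] -/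
theorem segRegion_shellSat_act (n : ℤ) {j : toyIndex.Label} (hj : j ≠ 0) (vQ : toyIndex.VQ) :
    segRegion (shellSat actFull.toLatticeSituation n (fun v _ => PsiNat v)) j vQ = ball j vQ := by
  unfold segRegion
  rw [dif_neg hj]
  ext x
  constructor
  · rintro ⟨ψ, hψ, t, ht0, ht1, rfl⟩
    have hb : ψ ⟨j, hj⟩ ∈ ball j vQ := (shellSat_act_PsiNat n vQ _ ψ).1 hψ ⟨j, hj⟩
    have hb' : |line j vQ (ψ ⟨j, hj⟩)| ≤ 1 := hb
    have hsm : line j vQ (t • ψ ⟨j, hj⟩) = t * line j vQ (ψ ⟨j, hj⟩) := by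
      have h := map_smul (line j vQ) t (ψ ⟨j, hj⟩ : signShells.Packet j vQ)
      rw [smul_eq_mul] at h
      exact h
    show |line j vQ (t • ψ ⟨j, hj⟩)| ≤ 1
    rw [hsm, abs_mul, abs_of_nonneg ht0]
    nlinarith [abs_nonneg (line j vQ (ψ ⟨j, hj⟩))]
  · intro hx
    refine ⟨fun j' => if h : j'.1 = j then h ▸ x else 0, (shellSat_act_PsiNat n vQ _ _).2 (fun j' => ?_), 1, zero_le_one, le_rfl, ?_⟩
    · by_cases h : j'.1 = j
      · obtain ⟨j'', hj''⟩ := j'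
        simp only at h
        subst h
        simp only [dite_true]
        exact hx
      · simp only [h, dite_false]; exact zero_mem_ball _ _
    · simp

/-- The union over `m` of the segment regions of the saturated Θ-data is `ball` on `𝔽_l^⋇`. [folklore] -/
theorem iUnion_segRegion_shellSat_act {j : toyIndex.Label} (hj : j ≠ 0) (vQ : toyIndex.VQ) :
    (⋃ m : ℤ, segRegion (shellSat actFull.toLatticeSituation actSetting.n ((actFull.toLatticeSituation.col actSetting.n).frobΨ m)) j vQ) =
      ball j vQ := by
  have h : ∀ m : ℤ, segRegion (shellSat actFull.toLatticeSituation actSetting.n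
      ((actFull.toLatticeSituation.col actSetting.n).frobΨ m)) j vQ = ball j vQ := fun m => segRegion_shellSat_act _ hj vQ
  simp_rw [h]; exact Set.iUnion_const _

/-- … and `{0}` at the zero label. [folklore] -/
theorem iUnion_segRegion_shellSat_act_zero (vQ : toyIndex.VQ) :
    (⋃ m : ℤ, segRegion (shellSat actFull.toLatticeSituation actSetting.n ((actFull.toLatticeSituation.col actSetting.n).frobΨ m)) 0 vQ) =
      {0} := by
  simp_rw [segRegion_zero]; exact Set.iUnion_const _

/-! ## The cells -/

/-- **P♮⁺ cell, RP-I05 `HInd3Hull`: HOLDS** (`ball ⊆ ball`; `{0} ⊆ {0}`). [folklore] -/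
theorem hInd3Hull_act : HInd3Hull actFull.toLatticeSituation actSetting segRegion := by
  intro m j vQ
  by_cases hj : j = 0
  · subst hj; rw [segRegion_zero, act_thetaHull_zero]
  · show segRegion (shellSat actFull.toLatticeSituation actSetting.n (fun v _ => PsiNat v)) j vQ ⊆ _
    rw [segRegion_shellSat_act _ hj, act_thetaHull hj]

/-- **P♮⁺ cell, RP-I05c (container bound `CandInternal11.H`): HOLDS** (`ball ⊆ ball`; `{0} ⊆ {0}`). [folklore] -/
theorem h11_act : CandInternal11.H actFull.toLatticeSituation actSetting segRegion := by
  intro j vQ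
  by_cases hj : j = 0
  · subst hj; rw [iUnion_segRegion_shellSat_act_zero, act_thetaHull_zero]
  · rw [iUnion_segRegion_shellSat_act hj, act_thetaHull hj]

/-- **P♮⁺ cell, RP-I06 `HQShellOrbit`: HOLDS** (`halfNeg ⊆ ball`). [folklore] -/
theorem hQShellOrbit_act : HQShellOrbit actFull.toLatticeSituation actSetting segRegion qDatumNat := by
  intro j vQ
  by_cases hj : j = 0
  · subst hj; rw [segRegion_zero, iUnion_segRegion_shellSat_act_zero]
  · rw [segRegion_qDatumNat hj, iUnion_segRegion_shellSat_act hj]; exact halfNeg_subset_ball j vQ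

/-- **P♮⁺ cell, RP-I18 (`CandInternal14.H`, 𝓘-inner link transport): HOLDS** — the (Ind2)-move `flipFamily` carrying the Θ-datum onto the
q-datum acts through the shell tuple `−onePt` (`−1 ∈ ball`): a UNIT-valued move is 𝓘-inner for free. [folklore] -/
theorem h14_act : CandInternal14.H actFull.toLatticeSituation actSetting qDatumNat := by
  refine ⟨0, flipFamily, fun v hv => subset_rfl, fun v hv ψ hψ => ?_⟩
  have hψ1 : ψ = onePt v := hψ
  subst hψ1
  refine ⟨signShells.starAut flipFamily v (onePt v), fun j => ?_, (act_onePt 0 v hv _).symm⟩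
  show |line j.1 (toyIndex.over v) (flipFamily j.1 (toyIndex.over v) (onePt v j))| ≤ 1
  rw [flipFamily_apply, map_neg, show onePt v j = lpt j.1 (toyIndex.over v) 1 from rfl, line_lpt]
  norm_num

/-- **P♮⁺ cell, RP-I06b `HQShellOrbitData`: HOLDS** (through RP-I18). [folklore] -/
theorem hQShellOrbitData_act : HQShellOrbitData actFull.toLatticeSituation actSetting qDatumNat :=
  CandInternal14.hQShellOrbitData_of_H _ _ _ h14_act

/-- **P♮⁺ cell, RP-I06c (`CandInternal5.H`): HOLDS** (from RP-I06). [folklore] -/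
theorem h5_act : CandInternal5.H actFull.toLatticeSituation actSetting segRegion qDatumNat :=
  CandInternal5.H_of_hQShellOrbit _ _ _ _ hQShellOrbit_act

/-- **P♮⁺ cell, RP-I06d q-side half `HQInShell`: HOLDS.** [folklore] -/
theorem hQInShell_act : CandInternal8.HQInShell actFull.toLatticeSituation actSetting segRegion qDatumNat := by
  intro j vQ
  show segRegion qDatumNat j vQ ⊆ ball j vQ
  by_cases hj : j = 0
  · subst hj; rw [segRegion_zero]; exact Set.singleton_subset_iff.2 (zero_mem_ball _ vQ)
  · rw [segRegion_qDatumNat hj]; exact halfNeg_subset_ball j vQ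

/-- **P♮⁺ cell, RP-I06d inflation half on `𝔽_l^⋇`: HOLDS** (`ball ⊆ ball`). [folklore] -/
theorem hShellInHull_act_labelSucc (i : Fin toyIndex.lstar) (vQ : toyIndex.VQ) :
    (actFull.toLatticeSituation.D actSetting.n).shellPk (Setting.labelSucc i) vQ ⊆ actSetting.thetaHull (Setting.labelSucc i) vQ := by
  rw [act_thetaHull (Setting.labelSucc_ne_zero _)]
  exact subset_rfl

/-- **SAT♮ for RP-I05 ∧ RP-I05c ∧ RP-I06 ∧ RP-I06b ∧ RP-I06c ∧ RP-I06d(q-half)** via the bed's engine: jointly satisfiable with typed Thm 3.11,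
BridgeHyps, |log(q)| > 0, the three pins, S (non-identified), the hull clause and the STRICT Statement. [folklore] -/
theorem I05_I06_satNatural :
    ∃ (T : ThetaIndex) (F : FullSituation T) (P : Cor312.Setting F.toLatticeSituation.toSituation)
      (ρ : (∀ v : T.V, v ∈ T.Vbad → Set (F.L.StarPacket v)) → ∀ (j : T.Label) (vQ : T.VQ), Set (F.L.Packet j vQ))
      (qK : ∀ v : T.V, v ∈ T.Vbad → Set (F.L.StarPacket v)),
      F.Statement ∧ BridgeHyps P ∧ P.AbsLogQPos ∧ PinnedRegions3 F.toLatticeSituation P ρ qK ∧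
        PilotKummerIndRelated F.toLatticeSituation P ρ qK ∧ PilotKummerCompatHull F.toLatticeSituation P ρ qK ∧
        (P.Statement ∧ ((P.negLogQ : ℝ) : WithTop ℝ) < P.negLogTheta) ∧
        (HInd3Hull F.toLatticeSituation P ρ ∧ CandInternal11.H F.toLatticeSituation P ρ ∧ HQShellOrbit F.toLatticeSituation P ρ qK ∧
          HQShellOrbitData F.toLatticeSituation P qK ∧ CandInternal5.H F.toLatticeSituation P ρ qK ∧
          CandInternal8.HQInShell F.toLatticeSituation P ρ qK) :=
  satNaturalAct_of_holds (fun S P ρ qK => HInd3Hull S P ρ ∧ CandInternal11.H S P ρ ∧ HQShellOrbit S P ρ qK ∧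
      HQShellOrbitData S P qK ∧ CandInternal5.H S P ρ qK ∧ CandInternal8.HQInShell S P ρ qK)
    ⟨hInd3Hull_act, h11_act, hQShellOrbit_act, hQShellOrbitData_act, h5_act, hQInShell_act⟩

/-- **SAT♮ for RP-I18 (with RP-I05)**: the 𝓘-inner link transport is jointly satisfiable with the typed interface, the pins, S (non-identified)
and the strict Statement — at a model whose Θ→q move is UNIT-valued. [folklore] -/
theorem I18_satNatural :
    ∃ (T : ThetaIndex) (F : FullSituation T) (P : Cor312.Setting F.toLatticeSituation.toSituation)
      (ρ : (∀ v : T.V, v ∈ T.Vbad → Set (F.L.StarPacket v)) → ∀ (j : T.Label) (vQ : T.VQ), Set (F.L.Packet j vQ))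
      (qK : ∀ v : T.V, v ∈ T.Vbad → Set (F.L.StarPacket v)),
      F.Statement ∧ BridgeHyps P ∧ P.AbsLogQPos ∧ PinnedRegions3 F.toLatticeSituation P ρ qK ∧
        PilotKummerIndRelated F.toLatticeSituation P ρ qK ∧ PilotKummerCompatHull F.toLatticeSituation P ρ qK ∧
        (P.Statement ∧ ((P.negLogQ : ℝ) : WithTop ℝ) < P.negLogTheta) ∧
        (HInd3Hull F.toLatticeSituation P ρ ∧ CandInternal14.H F.toLatticeSituation P qK) :=
  satNaturalAct_of_holds (fun S P ρ qK => HInd3Hull S P ρ ∧ CandInternal14.H S P qK) ⟨hInd3Hull_act, h14_act⟩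

end Summit.ABC.IUTFork.Repair.CandInternal2NatAct

end
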